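import Summits.CriticalPhenomena.PercolationContinuityZ3.Theorems.PercNearOneGluingNoHeavyQuantFarCycleBlockChain
import HarnessLib

/-!
# QUANT lane R8, front "FAR beyond trees", layer one — HUB FAMILIES II: THE HUB-DECOUPLED WEIGHTS OF AN ARBITRARY PENDANT BLOCK
# (`Block.fdecouple`: every anchor `v j` gets an independent stem `s(c, v j)` of weight `m_j = P_w(c ↔ v j in core)`, the core is killed, the hubs
# ride along) — core-agnostic version of `…QuantFarCycleBlockDecouple`

builds on p205010 (kernel theorem, internal audit signed; external expert review pending)

Support file (`--supports stmt-CriticalPhenomena-4575`), seat `prim-quant-p1` (gen 22); memo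
`run/shared/lean/prim/quant/prim-quant-p1-g22/FOR-LEAD-KHUB.md` §5–§6 (interface for the next front: pendant 2-connected cores that are not cycles).
Standard axioms; no sorries; one definition of weights (`Block.fdecouple`) plus bookkeeping.

Setting of `…QuantFarHubFamilyReach` (`Block.IsHubFamily c Z J v S`: block `Z` pendant at `c`, hubs `S j` at anchors `v j`, `j ∈ J`, ARBITRARY core).
* `Block.fdecouple c Z J v S w`: `w` off `Z` and on every hub's pairs; the stem `s(c, v j)` (`j ∈ J`) gets `Block.stem` weight `P_w(c ↔ v j in core)`;
  every other pair meeting `Z` gets `0`.  It hangs `Z` at `c` and each `S j` at `v j` (`Block.fdecouple_hangZ/hangS`), keeps the hub laws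
  (`Block.real_hub_fdecouple`), `P_{w'}(stem j open) = P_w(c ↔ v j in core)` (`Block.real_stem_fd`), and almost surely its open core pairs are stems
  (`Block.real_congr_fd`), so `c ↔ v j in core ⟺ stem j open` (`Block.coreReach_iff_stem_fd`) and the block count is
  `Block.stemCountF = Σ_{j ∈ J} 𝟙[stem j open]·W_j` (`Block.real_card_on_eq_stemCountF`).
The laws of the stem count and the transfer theorem modulo the law-level domination follow in `…QuantFarHubFamilyStems/Transfer`.
[cite: Grimmett1999, §1.3 p. 10; §2.2]; the construction [this work].
-/

noncomputable section

namespace Summit.CriticalPhenomena.PercolationContinuityZ3.Theorems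

namespace Quant

namespace Block

open Finset MeasureTheory Set
open Literature.Probability.LatticeModels
open Literature.Probability.Percolation
open Bundle (offZ avoid)
open scoped Classical

variable {n : ℕ}

/-- **The hub-decoupled weights of a pendant block with a hub family**: `w` off `Z` and on the hub pairs, stems `s(c, v j)` (`j ∈ J`) of weight
`P_w(c ↔ v j in core)`, all other pairs meeting `Z` get `0`. [this work] -/
def fdecouple (c : Fin n) (Z : Finset (Fin n)) (J : Finset ℕ) (v : ℕ → Fin n) (S : ℕ → Finset (Fin n)) (w : Sym2 (Fin n) → unitInterval) :
    Sym2 (Fin n) → unitInterval := fun e =>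
  if e ∈ avoid Z then w e
  else if h : ∃ j, j ∈ J ∧ e = s(c, v j) then stem c (v (Nat.find h)) Z (hubs J S) w
  else if ∃ j, j ∈ J ∧ e ∈ hubPairs (S j) (v j) then w e else 0

/-- `Σ_{j ∈ J} 𝟙[stem j open]·W_j`: the block count of the decoupled block (almost surely). [this work] -/
def stemCountF (c : Fin n) (J : Finset ℕ) (v : ℕ → Fin n) (S : ℕ → Finset (Fin n)) (A : Finset (Fin n)) (ω : BondConfig (Fin n)) : ℕ :=
  ∑ j ∈ J, if s(c, v j) ∈ ω then hubCount v S A j ω else 0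

section Family

variable {c : Fin n} {Z : Finset (Fin n)} {J : Finset ℕ} {v : ℕ → Fin n} {S : ℕ → Finset (Fin n)} (H : IsHubFamily c Z J v S)
  (w : Sym2 (Fin n) → unitInterval)
include H

/-- The cut vertex is not an anchor. [this work] -/
theorem c_ne_anchor {j : ℕ} (hj : j ∈ J) : c ≠ v j := fun h => H.cZ (h ▸ H.vZ j hj)

/-- The stem to `v j` determines `j ∈ J`. [this work] -/
theorem fstem_index_unique {j j' : ℕ} (hj : j ∈ J) (hj' : j' ∈ J) (h : s(c, v j) = s(c, v j')) : j = j' := by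
  rcases Sym2.eq_iff.1 h with ⟨-, h2⟩ | ⟨h1, -⟩
  · exact H.vinj j hj j' hj' h2
  · exact absurd h1 (c_ne_anchor H hj')

/-- A stem is not a hub pair. [this work] -/
theorem fstem_notMem_hubPairs {i j : ℕ} (hi : i ∈ J) (hj : j ∈ J) : s(c, v i) ∉ hubPairs (S j) (v j) := by
  intro h
  obtain ⟨⟨z, hz, hze⟩, -⟩ := (Finset.mem_filter.1 h).2
  rcases Sym2.mem_iff.1 hze with rfl | rfl
  · exact c_notMem_hub H hj hz
  · exact H.vS i hi j hj hz

/-- A stem does not avoid `Z`. [this work] -/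
theorem fstem_not_avoid {j : ℕ} (hj : j ∈ J) : s(c, v j) ∉ avoid Z :=
  fun h => (Finset.mem_filter.1 h).2 (v j) (H.vZ j hj) (Sym2.mem_mk_right _ _)

/-- A hub pair of `S j` has all its vertices in `Z`. [this work] -/
theorem mem_Z_of_hubPair_fd {j : ℕ} (hj : j ∈ J) {e : Sym2 (Fin n)} (he : e ∈ hubPairs (S j) (v j)) {y : Fin n} (hy : y ∈ e) : y ∈ Z := by
  obtain ⟨-, hin⟩ := (Finset.mem_filter.1 he).2
  rcases hin y hy with h | h
  · exact H.SZ j hj h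
  · exact h ▸ H.vZ j hj

omit H in
/-- `fdecouple` agrees with `w` off the block. [this work] -/
theorem fdecouple_of_avoid {e : Sym2 (Fin n)} (he : e ∈ avoid Z) : fdecouple c Z J v S w e = w e := by
  simp only [fdecouple, if_pos he]

/-- `fdecouple` on a stem. [this work] -/
theorem fdecouple_stem {j : ℕ} (hj : j ∈ J) : fdecouple c Z J v S w s(c, v j) = stem c (v j) Z (hubs J S) w := by
  have hex : ∃ j', j' ∈ J ∧ s(c, v j) = s(c, v j') := ⟨j, hj, rfl⟩
  simp only [fdecouple, if_neg (fstem_not_avoid H hj), dif_pos hex]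
  have hspec := Nat.find_spec hex
  rw [← fstem_index_unique H hj hspec.1 hspec.2]

/-- `fdecouple` keeps the hub weights. [this work] -/
theorem fdecouple_hub {j : ℕ} (hj : j ∈ J) {e : Sym2 (Fin n)} (he : e ∈ hubPairs (S j) (v j)) : fdecouple c Z J v S w e = w e := by
  have h1 : e ∉ avoid Z := by
    intro h
    obtain ⟨⟨z, hz, hze⟩, -⟩ := (Finset.mem_filter.1 he).2
    exact (Finset.mem_filter.1 h).2 z (H.SZ j hj hz) hze
  have h2 : ¬ ∃ i, i ∈ J ∧ e = s(c, v i) := by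
    rintro ⟨i, hi, rfl⟩
    exact fstem_notMem_hubPairs H hi hj he
  have h3 : ∃ j, j ∈ J ∧ e ∈ hubPairs (S j) (v j) := ⟨j, hj, he⟩
  simp only [fdecouple, if_neg h1, dif_neg h2, if_pos h3]

omit H in
/-- `fdecouple` vanishes on every other pair. [this work] -/
theorem fdecouple_zero {e : Sym2 (Fin n)} (h1 : e ∉ avoid Z) (h2 : ¬ ∃ j, j ∈ J ∧ e = s(c, v j))
    (h3 : ¬ ∃ j, j ∈ J ∧ e ∈ hubPairs (S j) (v j)) : (fdecouple c Z J v S w e : ℝ) = 0 := by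
  simp only [fdecouple, if_neg h1, dif_neg h2, if_neg h3]; rfl

/-- The decoupled weights hang `Z` at `c`. [this work] -/
theorem fdecouple_hangZ : ∀ x y : Fin n, x ≠ y → x ∈ Z → y ∉ Z → y ≠ c → (fdecouple c Z J v S w s(x, y) : ℝ) = 0 := by
  intro x y _ hx hy hyc
  refine fdecouple_zero w (not_avoid_of_mem hx) ?_ ?_
  · rintro ⟨j, hj, h⟩
    rcases Sym2.eq_iff.1 h with ⟨h1, -⟩ | ⟨-, h2⟩
    · exact H.cZ (h1 ▸ hx)
    · exact hyc h2
  · rintro ⟨j, hj, h⟩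
    exact hy (mem_Z_of_hubPair_fd H hj h (Sym2.mem_mk_right x y))

/-- The decoupled weights hang `S j` at `v j`. [this work] -/
theorem fdecouple_hangS {j : ℕ} (hj : j ∈ J) :
    ∀ x y : Fin n, x ≠ y → x ∈ S j → y ∉ S j → y ≠ v j → (fdecouple c Z J v S w s(x, y) : ℝ) = 0 := by
  intro x y _ hx hy hyv
  refine fdecouple_zero w (not_avoid_of_mem (H.SZ j hj hx)) ?_ ?_
  · rintro ⟨i, hi, h⟩
    rcases Sym2.eq_iff.1 h with ⟨h1, -⟩ | ⟨h1, -⟩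
    · exact c_notMem_hub H hj (h1 ▸ hx)
    · exact H.vS i hi j hj (h1 ▸ hx)
  · rintro ⟨i, hi, h⟩
    obtain ⟨-, hin⟩ := (Finset.mem_filter.1 h).2
    have hxi : x ∈ S i := by
      rcases hin x (Sym2.mem_mk_left x y) with h' | h'
      · exact h'
      · exact absurd (h' ▸ hx) (H.vS i hi j hj)
    have hij : i = j := by
      by_contra hij; exact Finset.disjoint_left.1 (H.disj i hi j hj hij) hxi hx
    subst hij
    rcases hin y (Sym2.mem_mk_right x y) with h' | h'
    · exact hy h'
    · exact hyv h'

/-! ## Almost surely the open core pairs are stems -/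

/-- The exceptional pairs of the decoupled block: non-loop pairs meeting `Z` that are neither stems nor hub pairs. [this work] -/
def fdForb (c : Fin n) (Z : Finset (Fin n)) (J : Finset ℕ) (v : ℕ → Fin n) (S : ℕ → Finset (Fin n)) : Finset (Sym2 (Fin n)) :=
  Finset.univ.filter fun e => ¬ e.IsDiag ∧ (∃ z ∈ Z, z ∈ e) ∧ (¬ ∃ j, j ∈ J ∧ e = s(c, v j)) ∧ ¬ ∃ j, j ∈ J ∧ e ∈ hubPairs (S j) (v j)

/-- Good configurations of the decoupled block. [this work] -/
def FdGood (c : Fin n) (Z : Finset (Fin n)) (J : Finset ℕ) (v : ℕ → Fin n) (S : ℕ → Finset (Fin n)) (ω : BondConfig (Fin n)) : Prop :=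
  Good c Z ω ∧ (∀ j ∈ J, Good (v j) (S j) ω) ∧ ∀ e ∈ core Z (hubs J S) ω, e.IsDiag ∨ ∃ j, j ∈ J ∧ e = s(c, v j)

omit H in
/-- Every exceptional pair carries decoupled weight `0`. [this work] -/
theorem fdForb_vanish : ∀ e ∈ fdForb c Z J v S, (fdecouple c Z J v S w e : ℝ) = 0 := by
  intro e he
  obtain ⟨-, ⟨z, hz, hze⟩, h2, h3⟩ := (Finset.mem_filter.1 he).2
  exact fdecouple_zero w (fun h => (Finset.mem_filter.1 h).2 z hz hze) h2 h3

/-- Off the exceptional pairs the configuration is good. [this work] -/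
theorem fdGood_of_forb {ω : BondConfig (Fin n)} (hω : ∀ e ∈ fdForb c Z J v S, e ∉ ω) : FdGood c Z J v S ω := by
  have forb : ∀ x y : Fin n, x ≠ y → (x ∈ Z ∨ y ∈ Z) → (¬ ∃ j, j ∈ J ∧ s(x, y) = s(c, v j)) →
      (¬ ∃ j, j ∈ J ∧ s(x, y) ∈ hubPairs (S j) (v j)) → s(x, y) ∉ ω := by
    intro x y hxy hxZ hns hnh
    refine hω _ (Finset.mem_filter.2 ⟨Finset.mem_univ _, ?_, ?_, hns, hnh⟩)
    · rw [Sym2.mk_isDiag_iff]; exact hxy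
    · rcases hxZ with h | h
      · exact ⟨x, h, Sym2.mem_mk_left _ _⟩
      · exact ⟨y, h, Sym2.mem_mk_right _ _⟩
  refine ⟨?_, ?_, ?_⟩
  · intro x y hxy he hx hy
    by_contra hyc
    refine forb x y hxy (Or.inl hx) ?_ ?_ he
    · rintro ⟨j, hj, h⟩
      rcases Sym2.eq_iff.1 h with ⟨h1, -⟩ | ⟨-, h2⟩
      · exact H.cZ (h1 ▸ hx)
      · exact hyc h2
    · rintro ⟨j, hj, h⟩
      exact hy (mem_Z_of_hubPair_fd H hj h (Sym2.mem_mk_right x y))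
  · intro j hj x y hxy he hx hy
    by_contra hyc
    refine forb x y hxy (Or.inl (H.SZ j hj hx)) ?_ ?_ he
    · rintro ⟨i, hi, h⟩
      rcases Sym2.eq_iff.1 h with ⟨h1, -⟩ | ⟨h1, -⟩
      · exact c_notMem_hub H hj (h1 ▸ hx)
      · exact H.vS i hi j hj (h1 ▸ hx)
    · rintro ⟨i, hi, h⟩
      obtain ⟨-, hin⟩ := (Finset.mem_filter.1 h).2
      have hxi : x ∈ S i := by
        rcases hin x (Sym2.mem_mk_left x y) with h' | h'
        · exact h'
        · exact absurd (h' ▸ hx) (H.vS i hi j hj)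
      have hij : i = j := by
        by_contra hij; exact Finset.disjoint_left.1 (H.disj i hi j hj hij) hxi hx
      subst hij
      rcases hin y (Sym2.mem_mk_right x y) with h' | h'
      · exact hy h'
      · exact hyc h'
  · intro e he
    obtain ⟨heω, hz, havoid⟩ := he
    induction e using Sym2.ind with
    | h x y =>
      by_cases hxy : x = y
      · left; rw [Sym2.mk_isDiag_iff]; exact hxy
      · right
        by_contra hns
        refine forb x y hxy ?_ hns ?_ heω
        · obtain ⟨z, hz, hze⟩ := hz
          rcases Sym2.mem_iff.1 hze with rfl | rfl
          · exact Or.inl hz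
          · exact Or.inr hz
        · rintro ⟨j, hj, h⟩
          obtain ⟨⟨z, hzS, hze⟩, -⟩ := (Finset.mem_filter.1 h).2
          exact havoid z (mem_hubs.2 ⟨j, hj, hzS⟩) hze

/-- Almost surely the decoupled configuration is good. [this work] -/
theorem real_congr_fd (U T : Set (BondConfig (Fin n))) (hUT : ∀ ω, FdGood c Z J v S ω → (ω ∈ U ↔ ω ∈ T)) :
    (prodBernoulli (fdecouple c Z J v S w)).real U = (prodBernoulli (fdecouple c Z J v S w)).real T :=
  real_congr_of_vanish _ (fdForb c Z J v S) (fdForb_vanish w) U T fun _ hω => hUT _ (fdGood_of_forb H hω)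

/-- **On a good configuration `c ↔ v j` through the core iff the stem `s(c, v j)` is open.** [this work] -/
theorem coreReach_iff_stem_fd {ω : BondConfig (Fin n)} (hω : FdGood c Z J v S ω) {j : ℕ} (hj : j ∈ J) :
    core Z (hubs J S) ω ∈ openConn c (v j) ↔ s(c, v j) ∈ ω := by
  have hcj : c ≠ v j := c_ne_anchor H hj
  constructor
  · intro h
    obtain ⟨p⟩ := (h : (openGraph (core Z (hubs J S) ω)).Reachable c (v j)).symm
    suffices key : ∀ (a b : Fin n) (_ : (openGraph (core Z (hubs J S) ω)).Walk a b), a = v j → b = c → s(c, v j) ∈ ω from key _ _ p rfl rfl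
    intro a b q
    cases q with
    | nil => intro ha hb; exact absurd (hb.symm.trans ha) hcj
    | cons hadj q' =>
      rename_i x
      intro ha _
      subst ha
      rw [openGraph_adj] at hadj
      obtain ⟨hcore, hne⟩ := hadj
      rcases hω.2.2 _ hcore with hdiag | ⟨i, hi, heq⟩
      · exact absurd (Sym2.mk_isDiag_iff.1 hdiag) hne
      · have hij : j = i := by
          rcases Sym2.eq_iff.1 heq with ⟨h1, -⟩ | ⟨h1, -⟩
          · exact absurd h1.symm hcj
          · exact H.vinj j hj i hi h1
        subst hij
        rw [heq] at hcore
        exact hcore.1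
  · intro h
    have hadj : (openGraph (core Z (hubs J S) ω)).Adj c (v j) := by
      rw [openGraph_adj]
      refine ⟨⟨h, ⟨v j, H.vZ j hj, Sym2.mem_mk_right _ _⟩, fun ℓ hℓ hmem => ?_⟩, hcj⟩
      obtain ⟨i, hi, hℓi⟩ := mem_hubs.1 hℓ
      rcases Sym2.mem_iff.1 hmem with rfl | rfl
      · exact c_notMem_hub H hi hℓi
      · exact H.vS j hj i hi hℓi
    exact hadj.reachable

/-- **The block count of the decoupled block is the stem count** (good configurations; relays are anchors or hub vertices). [this work] -/
theorem card_on_eq_stemCountF {ω : BondConfig (Fin n)} (hω : FdGood c Z J v S ω) {A : Finset (Fin n)}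
    (hA : ∀ a ∈ A ∩ Z, ∃ j ∈ J, a = v j ∨ a ∈ S j) :
    ((A ∩ Z).filter fun a => onZ Z ω ∈ openConn c a).card = stemCountF c J v S A ω := by
  rw [card_on_eq_family H hω.2.1 hA]
  unfold stemCountF hubCount
  refine Finset.sum_congr rfl fun j hj => ?_
  rw [coreReach_iff_stem_fd H hω hj]

/-- Events read off the decoupled block count have the probability of the same events read off the stem count. [this work] -/
theorem real_card_on_eq_stemCountF {A : Finset (Fin n)} (hA : ∀ a ∈ A ∩ Z, ∃ j ∈ J, a = v j ∨ a ∈ S j) (P : ℕ → Prop) :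
    (prodBernoulli (fdecouple c Z J v S w)).real {ω | P (((A ∩ Z).filter fun a => onZ Z ω ∈ openConn c a).card)} =
      (prodBernoulli (fdecouple c Z J v S w)).real {ω | P (stemCountF c J v S A ω)} :=
  real_congr_fd H w _ _ fun ω hω => by simp only [mem_setOf_eq, card_on_eq_stemCountF H hω hA]

/-! ## Laws under the decoupled weights -/

/-- The hub laws are unchanged (any event read off a hub count). [this work] -/
theorem real_hub_fdecouple (A : Finset (Fin n)) {j : ℕ} (hj : j ∈ J) (P : ℕ → Prop) :
    (prodBernoulli (fdecouple c Z J v S w)).real {ω | P (hubCount v S A j ω)} = (prodBernoulli w).real {ω | P (hubCount v S A j ω)} :=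
  prodBernoulli_real_eq_of_determinedBy _ _ (fun _ he => fdecouple_hub H w hj (Finset.mem_coe.1 he)) ((readsOff_hubCount v S A j).determinedBy P)
    (Set.toFinite _).measurableSet

/-- Events read off the inner pairs of a hub are unchanged. [this work] -/
theorem real_inS_fdecouple {j : ℕ} (hj : j ∈ J) (P : BondConfig (Fin n) → Prop) :
    (prodBernoulli (fdecouple c Z J v S w)).real {ω | P (inS (S j) (v j) ω)} = (prodBernoulli w).real {ω | P (inS (S j) (v j) ω)} :=
  prodBernoulli_real_eq_of_determinedBy _ _ (fun _ he => fdecouple_hub H w hj (Finset.mem_coe.1 he)) (determinedBy_inS (S j) (v j) P)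
    (Set.toFinite _).measurableSet

/-- **`P_{w'}(stem j open) = P_w(c ↔ v j in core)`.** [this work] -/
theorem real_stem_fd {j : ℕ} (hj : j ∈ J) :
    (prodBernoulli (fdecouple c Z J v S w)).real {ω | s(c, v j) ∈ ω} = (prodBernoulli w).real {ω | core Z (hubs J S) ω ∈ openConn c (v j)} := by
  rw [prodBernoulli_real_setOf_mem, fdecouple_stem H w hj]
  rfl

/-- Internal marginal of an anchor under the decoupled weights: `P_{w'}(c ↔ v j on Z) = P_w(c ↔ v j in core)`. [this work] -/
theorem real_onReach_anchor_fd {j : ℕ} (hj : j ∈ J) :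
    (prodBernoulli (fdecouple c Z J v S w)).real {ω | onZ Z ω ∈ openConn c (v j)} = (prodBernoulli w).real {ω | core Z (hubs J S) ω ∈ openConn c (v j)} := by
  rw [← real_stem_fd H w hj]
  exact real_congr_fd H w _ _ fun ω hω => by
    simp only [mem_setOf_eq]
    rw [show (onZ Z ω ∈ openConn c (v j)) = (openGraph (onZ Z ω)).Reachable c (v j) from rfl,
      on_reach_iff_core_family H hω.2.1 (fun i hi => H.vS j hj i hi)]
    exact coreReach_iff_stem_fd H hω hj

/-- Internal marginal of a hub vertex under the decoupled weights:
`P_{w'}(c ↔ a on Z) = P_w(c ↔ v j in core) · P_w(v j ↔ a inside)` for `a ∈ S j`. [this work] -/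
theorem real_onReach_hub_fd {j : ℕ} (hj : j ∈ J) {a : Fin n} (ha : a ∈ S j) :
    (prodBernoulli (fdecouple c Z J v S w)).real {ω | onZ Z ω ∈ openConn c a} =
      (prodBernoulli w).real {ω | core Z (hubs J S) ω ∈ openConn c (v j)} * (prodBernoulli w).real {ω | inS (S j) (v j) ω ∈ openConn (v j) a} := by
  have hmeas : ∀ U : Set (BondConfig (Fin n)), MeasurableSet U := fun U => (Set.toFinite U).measurableSet
  have h1 : (prodBernoulli (fdecouple c Z J v S w)).real {ω | onZ Z ω ∈ openConn c a} =
      (prodBernoulli (fdecouple c Z J v S w)).real ({ω | s(c, v j) ∈ ω} ∩ {ω | inS (S j) (v j) ω ∈ openConn (v j) a}) :=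
    real_congr_fd H w _ _ fun ω hω => by
      simp only [mem_setOf_eq, Set.mem_inter_iff]
      rw [show (onZ Z ω ∈ openConn c a) = (openGraph (onZ Z ω)).Reachable c a from rfl, on_reach_hub_iff_family H hω.2.1 hj ha]
      exact and_congr (coreReach_iff_stem_fd H hω hj) Iff.rfl
  have dS : DeterminedBy {ω : BondConfig (Fin n) | s(c, v j) ∈ ω} (↑({s(c, v j)} : Finset (Sym2 (Fin n))) : Set (Sym2 (Fin n))) :=
    (readsOff_mem s(c, v j)).determinedBy id
  have hd : Disjoint ({s(c, v j)} : Finset (Sym2 (Fin n))) (hubPairs (S j) (v j)) := by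
    rw [Finset.disjoint_singleton_left]; exact fstem_notMem_hubPairs H hj hj
  rw [h1, prodBernoulli_real_inter_of_determinedBy_disjoint _ hd dS (determinedBy_inS (S j) (v j) fun η => η ∈ openConn (v j) a) (hmeas _) (hmeas _),
    real_stem_fd H w hj, real_inS_fdecouple H w hj]

end Family

end Block

end Quant

end Summit.CriticalPhenomena.PercolationContinuityZ3.Theorems
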